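import Literature.NumberTheory.Transcendental.CurvePeriodsEllipticCMIsogenyProofs
import Literature.NumberTheory.Transcendental.CurvePeriodsEllipticPathsProofs
import Literature.NumberTheory.Transcendental.CurvePeriodsEllipticEndgameHolds
import Literature.NumberTheory.Transcendental.OnePeriodsMasserCMProofs
import HarnessLib

/-!
# Periods of curve type on an elliptic curve, XIII: closed paths on CM curves — UNCONDITIONAL

Companion of `Literature/NumberTheory/Transcendental/CurvePeriods.lean` (Huber–Wüstholz 2022,
Thm. 13.3 (2) = Kontsevich's period conjecture for periods of curve type, rendered on explicit
period symbols `(Z, ω, γ)` with the elementary relations (R1)–(R5); general statement: the named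
fact `HuberWustholzCurvePeriods`) and of `CurvePeriodsEllipticCMIsogenyProofs.lean` (complex
multiplication `[α]` as functoriality). For the affine Weierstrass curve
`E_L : y² = x³ − (g₂/4)x − g₃/4` of a period pair `L` with algebraic `g₂, g₃` AND COMPLEX
MULTIPLICATION, the theorem is proved for CLOSED paths — where the non-CM files
(`CurvePeriodsEllipticEndgameHolds.lean`, `CurvePeriodsEllipticPathsHolds.lean`) need the
hypothesis `¬ L.HasCM` of the analytic subgroup theorem for `𝔾ₐ × 𝔾ₘ^ι × (E♮)^κ`:

* `Ell.exists_liftData_rel_closed` — a closed-path symbol on `E_L` is `a S₀[D] + b S₁[D] + e𝟙`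
  for a lift `D : z₀ ↝ z₁` with `z₁ − z₀ ∈ Λ`;
* `Ell.exists_cm_loop_relations` — **the CM relations between the basic loops**: at a generic
  algebraic base point `t₀`, with lifts `DU 0 : t₀ ↝ t₀ + ω₁`, `DU 1 : t₀ ↝ t₀ + ω₂`,
  `S₀[DU 1] ∼ τ₀ S₀[DU 0]` and `S₁[DU 1] ∼ p S₁[DU 0] + q S₀[DU 0] + r𝟙` with `τ₀, p, q, r ∈ ℚ̄`
  — from `CMReps.span_cmul_theta0/1` along a complex multiplication `α ∉ ℤ`
  (`αω₁ = m₁ω₁ + n₁ω₂`, `n₁ ≠ 0`), translation by the algebraic point `φ((α − 1)t₀)` and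
  `ℤ`-linearity (`Ell.zexpand`); these are the relations `ω₂ = τω₁` and Masser's Lemma 3.1
  (`Aη₁ − Cτη₂ = κω₂`) at the level of symbols, INDUCED BY FUNCTORIALITY as Theorem 13.3 (2)
  predicts;
* `huberWustholzCurvePeriods_of_ellipticCMLoops` — **Theorem 13.3 (2) for closed paths on a CM
  elliptic curve together with closed paths on `𝔾ₘ` and `𝔸¹`, PROVED**: the normal form has
  period `2Aω₁ − 2Bη₁ + 2πi·Q + E`, and `1, 2πi, ω₁, η₁` are `ℚ̄`-linearly independent by Masser's
  Theorem III (`masser_ellipticPeriods_cm_holds`, proved in the tree from Chudnovsky's theorem);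
* `huberWustholzCurvePeriods_ellipticLoops_all` — **for EVERY lattice with algebraic invariants,
  CM or not**: closed paths on `E_L`, closed paths on `𝔾ₘ`, and `𝔸¹` (by cases, with
  `huberWustholzCurvePeriods_ellipticLoops` of `CurvePeriodsEllipticEndgameHolds.lean`).

What is NOT here: open paths on a CM curve (this needs an analytic subgroup theorem for CM
curves, where the algebraic subgroups of `E^κ` are given by `End(E)`-linear relations), several
curves, genus `≥ 2` — the general named fact `HuberWustholzCurvePeriods`.

## References

* A. Huber, G. Wüstholz, *Transcendence and Linear Relations of 1-Periods*, Cambridge Tracts in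
  Mathematics 227, CUP 2022 [HuberWustholz2022]: Thm. 13.3 (2) (p. 121 of the held text), §13.2
  (pp. 122–125), §18.1 (p. 160).
* D. Masser, *Elliptic Functions and Transcendence*, LNM 437, Springer 1975, Ch. III Thm. III
  (p. 36) and Lemma 3.1. [Masser1975]
* D. A. Cox, *Primes of the form x² + ny²*, 2nd ed., Wiley 2013, §10.B Thm. 10.14. [Cox2013]
-/

noncomputable section

open scoped BigOperators
open scoped PeriodPair
open scoped Topology
open MvPolynomial Set Complex Filter Metric

namespace Literature.NumberTheory.Transcendental

namespace CurvePeriods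

set_option quotPrecheck false in
/-- Membership in the `ℚ̄`-span of the elementary relations, in the format of the conclusion of
`HuberWustholzCurvePeriods`. -/
local notation "InSpan" c:max => ∃ (k : ℕ) (ρ : Fin k → (PeriodSymbol →₀ ℂ)) (a : Fin k → ℂ),
  (∀ l, IsElementaryRelation (ρ l)) ∧ (∀ l, IsAlgebraic ℚ (a l)) ∧ c = ∑ l, a l • ρ l

namespace Ell

section CM

variable {L : PeriodPair} (h₂ : IsAlgebraic ℚ L.g₂) (h₃ : IsAlgebraic ℚ L.g₃)

local notation3 "S₀[" D "]" => LiftData.sym h₂ h₃ D (theta0 L) (hasAlgCoeffs_theta0 L h₂ h₃)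
local notation3 "S₁[" D "]" => LiftData.sym h₂ h₃ D (theta1 L) (hasAlgCoeffs_theta1 L h₂ h₃)
local notation3 "𝟙" => (Finsupp.single PeriodSymbol.unit (1 : ℂ) : PeriodSymbol →₀ ℂ)

/-! ### Lifts of closed paths -/

omit h₂ h₃ in
/-- **A non-integer multiplier moves `ω₁` off its line**: `αω₁ = m₁ω₁ + n₁ω₂` with `n₁ ≠ 0`.
[cite: Masser1975, Ch. III Lemma 3.1 (proof)] -/
theorem exists_coords_mul_ω₁ {α : ℂ} (hαZ : ∀ n : ℤ, α ≠ n)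
    (hα : ∀ l ∈ L.lattice, α * l ∈ L.lattice) :
    ∃ m₁ n₁ : ℤ, α * L.ω₁ = m₁ * L.ω₁ + n₁ * L.ω₂ ∧ n₁ ≠ 0 := by
  obtain ⟨a, b, hab⟩ := PeriodPair.mem_lattice.mp (hα _ L.ω₁_mem_lattice)
  refine ⟨a, b, hab.symm, ?_⟩
  rintro rfl
  apply hαZ a
  have h0 : (α - a) * L.ω₁ = 0 := by push_cast at hab; linear_combination -hab
  rcases mul_eq_zero.mp h0 with h | h
  · linear_combination h
  · exact absurd h (by simpa using L.indep.ne_zero 0)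

/-- **Every CLOSED-path symbol `(E_L, ω, γ)` is `a·S₀[D] + b·S₁[D] + e·𝟙` for a lift `D : z₀ ↝ z₁`
with `z₁ − z₀ ∈ Λ`** (`Ell.exists_lift'`, `Ell.lift_sub_mem_lattice`, `Weier.exists_rel_symbol`).
[cite: HuberWustholz2022, §13.2 (p. 123), §3.3.1 (p. 44)] -/
theorem exists_liftData_rel_closed (ω : Fin 2 → MvPolynomial (Fin 2) ℂ)
    (hω : ∀ k, HasAlgCoeffs (ω k)) (γ : CurvePath (curve L)) (hcl : γ.toFun 1 = γ.toFun 0) :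
    ∃ (z₀ z₁ : ℂ) (D : LiftData L z₀ z₁) (a b e : ℂ), z₁ - z₀ ∈ L.lattice ∧
      IsAlgebraic ℚ a ∧ IsAlgebraic ℚ b ∧ IsAlgebraic ℚ e ∧
      InSpan (Finsupp.single (⟨curve L, smooth L h₂ h₃, ω, hω, γ⟩ : PeriodSymbol) (1 : ℂ) -
        a • S₀[D] - b • S₁[D] - e • 𝟙) := by
  have hE := smooth L h₂ h₃
  obtain ⟨g, hgC, hgΛ, hgφ, hv0, hv1⟩ := exists_lift' L γ
  have hmem : g 1 - g 0 ∈ L.lattice := lift_sub_mem_lattice L hgΛ hgφ hcl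
  set D : LiftData L (g 0) (g 1) := ⟨g, hgC, hgΛ, rfl, rfl, hv0, hv1⟩ with hD
  obtain ⟨a, b, e, ha, hb, he, hrel⟩ := Weier.exists_rel_symbol (A L) (B L) (isAlgebraic_A L h₂)
    (isAlgebraic_B L h₃) (disc_ne_zero L) ω hω γ
  have r0 := mem_span_sub_of_eqOn hE (theta0 L) (hasAlgCoeffs_theta0 L h₂ h₃) γ D.path
    (fun t ht => by rw [LiftData.path_toFun]; exact hgφ t ht)
  have r1 := mem_span_sub_of_eqOn hE (theta1 L) (hasAlgCoeffs_theta1 L h₂ h₃) γ D.path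
    (fun t ht => by rw [LiftData.path_toFun]; exact hgφ t ht)
  refine ⟨g 0, g 1, D, a, b, e, hmem, ha, hb, he, ?_⟩
  obtain ⟨K, ρ, cf, hρ, hcf, hsum⟩ := span_add (span_add hrel (span_smul ha r0)) (span_smul hb r1)
  refine ⟨K, ρ, cf, hρ, hcf, ?_⟩
  rw [← hsum]
  simp only [LiftData.sym, smul_sub]
  abel

/-! ### The CM relations between the basis loops -/

/-- **The CM relations between the basic loops, at a generic algebraic base point.** Let `Λ` have
algebraic invariants and complex multiplication. For every finite `B₀ ⊂ ℂ` there are an algebraic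
base point `t₀ ∉ B₀ + Λ`, lifts `D₁ : t₀ ↝ t₀ + ω₁`, `D₂ : t₀ ↝ t₀ + ω₂` and algebraic numbers
`τ₀, p, q, r` with
`S₀[D₂] ∼ τ₀ S₀[D₁]` and `S₁[D₂] ∼ p S₁[D₁] + q S₀[D₁] + r·𝟙`
modulo the elementary relations. Proof: pick a complex multiplication `α ∉ ℤ`, `αΛ ⊆ Λ`, write
`αω₁ = m₁ω₁ + n₁ω₂` (`n₁ ≠ 0`); choose `D₁` along a path avoiding `α⁻¹Λ`; by the CM relations
(`CMReps.span_cmul_theta0/1`) `S[φ∘(αD₁)] ∼ α S[D₁]` (resp. the `θ₁`-version), by translation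
by the algebraic point `φ((α − 1)t₀)` (`LiftData.span_translate_theta0/1`)
`S[αt₀ ↝ αt₀ + αω₁] ∼ S[t₀ ↝ t₀ + αω₁]`, and by `ℤ`-linearity (`Ell.zexpand`)
`S[t₀ ↝ t₀ + αω₁] ∼ m₁ S[D₁] + n₁ S[D₂]`; divide by `n₁`.
[cite: HuberWustholz2022, Thm. 13.3 (2) (p. 121), §13.2] [cite: Masser1975, Ch. III Lemma 3.1] -/
theorem exists_cm_loop_relations (hCM : L.HasCM) (B₀ : Finset ℂ) :
    ∃ (t₀ : ℂ) (DU : ∀ l : Fin 2, LiftData L t₀ (t₀ + ![L.ω₁, L.ω₂] l)) (τ₀ p q r : ℂ),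
      IsAlgPt L t₀ ∧ (∀ b ∈ B₀, t₀ - b ∉ L.lattice) ∧
      IsAlgebraic ℚ τ₀ ∧ IsAlgebraic ℚ p ∧ IsAlgebraic ℚ q ∧ IsAlgebraic ℚ r ∧
      InSpan (S₀[DU 1] - τ₀ • S₀[DU 0]) ∧
      InSpan (S₁[DU 1] - p • S₁[DU 0] - q • S₀[DU 0] - r • 𝟙) := by
  classical
  obtain ⟨α, hαZ, hαΛ⟩ := hCM
  have hα0 : α ≠ 0 := by simpa using hαZ 0
  have hα1 : α - 1 ≠ 0 := by
    have h := hαZ 1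
    intro h'
    exact h (by push_cast; linear_combination h')
  have hα2 : 2 - α ≠ 0 := by
    have h := hαZ 2
    intro h'
    exact h (by push_cast; linear_combination -h')
  have hαΛ1 : ∀ l ∈ L.lattice, (α - 1) * l ∈ L.lattice := fun l hl => by
    rw [sub_mul, one_mul]; exact sub_mem (hαΛ l hl) hl
  have hαΛ2 : ∀ l ∈ L.lattice, (2 - α) * l ∈ L.lattice := fun l hl => by
    rw [sub_mul]
    refine sub_mem ?_ (hαΛ l hl)
    simpa [two_mul] using add_mem hl hl
  obtain ⟨Sα, hR⟩ := exists_cmReps hα0 hαΛ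
  obtain ⟨S₁', hR₁⟩ := exists_cmReps hα1 hαΛ1
  obtain ⟨S₂', hR₂⟩ := exists_cmReps hα2 hαΛ2
  obtain ⟨m₁, n₁, hcoord, hn₁⟩ := exists_coords_mul_ω₁ hαZ hαΛ
  -- the data of `zexpand` for `αω₁ = m₁ω₁ + n₁ω₂`
  set mv : Fin 2 → ℂ := ![L.ω₁, L.ω₂] with hmv
  set nv : Fin 2 → ℤ := ![m₁, n₁] with hnv
  have hmvA : ∀ l, AlgLog L (mv l) := by
    intro l
    fin_cases l
    · exact algLog_of_mem L.ω₁_mem_lattice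
    · exact algLog_of_mem L.ω₂_mem_lattice
  obtain ⟨Bz, hBz⟩ := zexpand (L := L) h₂ h₃ 2 mv hmvA nv
  -- the generic base point
  set B : Finset ℂ := B₀ ∪ Bz ∪ (Sα ∪ S₁' ∪ S₂') with hB
  obtain ⟨t₀, ht₀, hgen⟩ := exists_generic_algPt L h₂ h₃ B
  have hgen0 : ∀ b ∈ B₀, t₀ - b ∉ L.lattice := fun b hb => hgen b (by simp [hB, hb])
  have hgenz : ∀ b ∈ Bz, t₀ - b ∉ L.lattice := fun b hb => hgen b (by simp [hB, hb])
  have notMem_of_reps : ∀ {β : ℂ} {Sβ : Finset ℂ}, CMReps L β Sβ → (∀ c ∈ Sβ, t₀ - c ∉ L.lattice) →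
      β * t₀ ∉ L.lattice := fun hRβ hc h => by
    obtain ⟨c, hcS, hc'⟩ := (hRβ.reps t₀).1 h
    exact hc c hcS hc'
  have hαt₀ : α * t₀ ∉ L.lattice :=
    notMem_of_reps hR fun c hc => hgen c (by simp [hB, hc])
  have hα1t₀ : (α - 1) * t₀ ∉ L.lattice :=
    notMem_of_reps hR₁ fun c hc => hgen c (by simp [hB, hc])
  have hα2t₀ : (2 - α) * t₀ ∉ L.lattice :=
    notMem_of_reps hR₂ fun c hc => hgen c (by simp [hB, hc])
  have ht₀ω₁ : IsAlgPt L (t₀ + L.ω₁) := ht₀.add_of_mem L.ω₁_mem_lattice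
  have hαω₁ : α * L.ω₁ ∈ L.lattice := hαΛ _ L.ω₁_mem_lattice
  have ht₀αω₁ : IsAlgPt L (t₀ + α * L.ω₁) := ht₀.add_of_mem hαω₁
  -- the path of `D₁`, avoiding `α⁻¹Λ`
  set Sset : Set ℂ := {x | α * x ∈ L.lattice} with hSset
  have hfin : ∀ (p : ℂ) (R : ℝ), (Sset ∩ closedBall p R).Finite := by
    intro p R
    have e : Sset = ((L.mulLeft α⁻¹ (inv_ne_zero hα0)).lattice : Set ℂ) := by
      ext x
      rw [hSset, Set.mem_setOf_eq, SetLike.mem_coe, PeriodPair.mem_mulLeft_inv_lattice hα0]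
    rw [e]
    exact finite_lattice_inter_closedBall _ p R
  have hb : t₀ + L.ω₁ ∉ Sset := by
    intro h
    rw [hSset, Set.mem_setOf_eq, mul_add] at h
    exact hαt₀ (by simpa using sub_mem h hαω₁)
  obtain ⟨g, hg, hg0, hg1, hgS⟩ := exists_path_avoiding hfin (a := t₀) (b := t₀ + L.ω₁) hαt₀ hb
  have hαg : ∀ t ∈ Icc (0 : ℝ) 1, α * g t ∉ L.lattice := fun t ht => hgS t ht
  have hΛg : ∀ t ∈ Icc (0 : ℝ) 1, g t ∉ L.lattice := fun t ht => hR.notMem_of_mul_notMem (hαg t ht)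
  set D₁ : LiftData L t₀ (t₀ + L.ω₁) := ⟨g, hg, hΛg, hg0, hg1, ht₀, ht₀ω₁⟩ with hD₁
  -- the basis lifts `DU l : t₀ ↝ t₀ + ω_l` and the comparison of `D₁` with `DU 0`
  obtain ⟨hDUalg, -, hall⟩ := hBz t₀ ht₀ hgenz
  set DU : ∀ l : Fin 2, LiftData L t₀ (t₀ + mv l) := fun l =>
    (LiftData.nonempty (L := L) ht₀ (hDUalg l)).some with hDU
  have rD0 : InSpan (S₀[DU 0] - S₀[D₁]) := by
    have h := LiftData.span_sub h₂ h₃ (DU 0) (D₁.cast rfl rfl) (theta0 L) (hasAlgCoeffs_theta0 L h₂ h₃)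
    rwa [LiftData.sym_cast] at h
  have rD1 : InSpan (S₁[DU 0] - S₁[D₁]) := by
    have h := LiftData.span_sub h₂ h₃ (DU 0) (D₁.cast rfl rfl) (theta1 L) (hasAlgCoeffs_theta1 L h₂ h₃)
    rwa [LiftData.sym_cast] at h
  -- the lift `αg : αt₀ ↝ αt₀ + αω₁`
  have hαt₀alg : IsAlgPt L (α * t₀) := hR.isAlgPt_mul h₂ h₃ ht₀ hαt₀
  have hαend : IsAlgPt L (α * t₀ + α * L.ω₁) := hαt₀alg.add_of_mem hαω₁
  have hg' : ContDiff ℝ 1 fun t => α * g t := contDiff_const.mul hg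
  set Dα : LiftData L (α * t₀) (α * t₀ + α * L.ω₁) :=
    ⟨fun t => α * g t, hg', hαg, by simp only [hg0], by simp only [hg1, mul_add], hαt₀alg, hαend⟩
    with hDα
  -- the CM relations along `g`
  have rc0 : InSpan (S₀[Dα] - α • S₀[D₁]) :=
    hR.span_cmul_theta0 h₂ h₃ hg hαg hΛg D₁.alg0 D₁.alg1 hg' Dα.alg0 Dα.alg1
  have rc1 : InSpan (S₁[Dα] - bC α Sα • S₁[D₁] - aC L α Sα • S₀[D₁] +
      (eval (psiC L Sα (g 1)) (GC L α Sα) - eval (psiC L Sα (g 0)) (GC L α Sα)) • 𝟙) :=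
    hR.span_cmul_theta1 h₂ h₃ hg hαg hΛg D₁.alg0 D₁.alg1 hg' Dα.alg0 Dα.alg1
  have hGd : IsAlgebraic ℚ (eval (psiC L Sα (g 1)) (GC L α Sα) -
      eval (psiC L Sα (g 0)) (GC L α Sα)) := by
    rw [hg0, hg1]
    exact (hR.isAlgebraic_eval_GC h₂ h₃ ht₀ω₁).sub (hR.isAlgebraic_eval_GC h₂ h₃ ht₀)
  -- translation by the algebraic point `v = (α − 1)t₀`
  set v : ℂ := (α - 1) * t₀ with hv
  have hvalg : IsAlgPt L v := hR₁.isAlgPt_mul h₂ h₃ ht₀ hα1t₀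
  have hne : ℘[L] t₀ ≠ ℘[L] v := by
    refine (weierstrassP_ne_iff L ht₀.1 hvalg.1).2 ⟨?_, ?_⟩
    · have e : t₀ + v = α * t₀ := by rw [hv]; ring
      rw [e]; exact hαt₀
    · have e : t₀ - v = (2 - α) * t₀ := by rw [hv]; ring
      rw [e]; exact hα2t₀
  have hne' : ℘[L] (t₀ + α * L.ω₁) ≠ ℘[L] v := by
    rwa [L.weierstrassP_add_coe t₀ ⟨α * L.ω₁, hαω₁⟩]
  obtain ⟨Dtr⟩ := LiftData.nonempty (L := L) ht₀ ht₀αω₁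
  have ea : α * t₀ = t₀ + v := by rw [hv]; ring
  have eb : α * t₀ + α * L.ω₁ = t₀ + α * L.ω₁ + v := by rw [hv]; ring
  have rt0 := LiftData.span_translate_theta0 h₂ h₃ hvalg Dtr (Dα.cast ea eb) hne hne'
  have rt1 := LiftData.span_translate_theta1 h₂ h₃ hvalg Dtr (Dα.cast ea eb) hne hne'
  rw [LiftData.sym_cast] at rt0 rt1
  have hκ := isAlgebraic_translate_const L hvalg ht₀ ht₀αω₁
  -- `ℤ`-linearity: `S[t₀ ↝ t₀ + αω₁] ∼ m₁ S[DU 0] + n₁ S[DU 1]`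
  have esum : t₀ + α * L.ω₁ = t₀ + ∑ l, (nv l : ℂ) * mv l := by
    rw [Fin.sum_univ_two, hcoord]
    simp [hnv, hmv]
  obtain ⟨rx0, cx, hcx, rx1⟩ := hall (Dtr.cast rfl esum) DU
  rw [LiftData.sym_cast] at rx0 rx1
  simp only [Fin.sum_univ_two] at rx0 rx1
  have hn0 : (n₁ : ℂ) ≠ 0 := Int.cast_ne_zero.mpr hn₁
  have hninv : IsAlgebraic ℚ ((n₁ : ℂ)⁻¹) := (isAlgebraic_int n₁).inv
  have hαA := hR.isAlgebraic
  have hm₁ : IsAlgebraic ℚ (m₁ : ℂ) := isAlgebraic_int m₁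
  have hmv0 : (nv 0 : ℂ) = m₁ := by simp [hnv]
  have hmv1 : (nv 1 : ℂ) = n₁ := by simp [hnv]
  rw [hmv0, hmv1] at rx0 rx1
  -- assemble
  refine ⟨t₀, DU, (α - m₁) / n₁, (bC α Sα - m₁) / n₁, aC L α Sα / n₁,
    -((eval (psiC L Sα (g 1)) (GC L α Sα) - eval (psiC L Sα (g 0)) (GC L α Sα) +
      (eval (psiT L v (t₀ + α * L.ω₁)) (rPolyT L v) - eval (psiT L v t₀) (rPolyT L v)) + cx)) / n₁,
    ht₀, hgen0, ?_, ?_, ?_, ?_, ?_, ?_⟩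
  · rw [div_eq_mul_inv]; exact (hαA.sub hm₁).mul hninv
  · rw [div_eq_mul_inv]; exact (hR.isAlgebraic_bC.sub hm₁).mul hninv
  · rw [div_eq_mul_inv]; exact (hR.isAlgebraic_aC h₂ h₃).mul hninv
  · rw [div_eq_mul_inv]; exact ((hGd.add hκ).add hcx).neg.mul hninv
  · -- `n₁ S₀[DU 1] ∼ (α − m₁) S₀[DU 0]`
    obtain ⟨K, ρ, cf, hρ, hcf, hsum⟩ :=
      span_smul hninv (span_sub (span_sub (span_sub rc0 rx0) rt0) (span_smul hαA rD0))
    refine ⟨K, ρ, cf, hρ, hcf, ?_⟩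
    rw [← hsum]
    simp only [smul_sub, smul_add, smul_smul]
    rw [show (n₁ : ℂ)⁻¹ * n₁ = 1 from inv_mul_cancel₀ hn0, one_smul]
    module
  · obtain ⟨K, ρ, cf, hρ, hcf, hsum⟩ :=
      span_smul hninv (span_sub (span_sub (span_sub (span_sub rc1 rx1) rt1)
        (span_smul hR.isAlgebraic_bC rD1)) (span_smul (hR.isAlgebraic_aC h₂ h₃) rD0))
    refine ⟨K, ρ, cf, hρ, hcf, ?_⟩
    rw [← hsum]
    simp only [smul_sub, smul_add, smul_smul]
    rw [show (n₁ : ℂ)⁻¹ * n₁ = 1 from inv_mul_cancel₀ hn0, one_smul]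
    module

end CM

end Ell

/-! ### The theorem: closed paths on a CM elliptic curve, with closed paths on `𝔾ₘ` and `𝔸¹` -/

section Main

/-- **Huber–Wüstholz, Theorem 13.3 (2), for CLOSED paths on an elliptic curve WITH complex
multiplication, together with closed paths on `𝔾ₘ` and `𝔸¹` — PROVED.** Let `Λ` be a lattice with
algebraic invariants `g₂, g₃` and complex multiplication, `E_L : y² = x³ − (g₂/4)x − g₃/4`. Every
vanishing `ℚ̄`-linear combination of period symbols `(E_L, ω, γ)` and `(𝔾ₘ, ω, γ)` with `γ` CLOSED
(any polynomial forms over `ℚ̄`, any `C¹` loops at algebraic points) and `(𝔸¹, ω, γ)` (any paths)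
is a `ℚ̄`-linear combination of the elementary relations (R1)–(R5). The periods concerned are the
`ℚ̄`-combinations of `1`, `2πi`, `ω₁, ω₂, η₁, η₂`, which span a `4`-dimensional `ℚ̄`-space with
basis `1, 2πi, ω₁, η₁` (Masser 1975, Thm. III): the relations expressing `ω₂, η₂` — `ω₂ = τω₁` and
Masser's Lemma 3.1 — are INDUCED BY FUNCTORIALITY along the complex multiplication
`[α] : E ∖ ker[α] → E` (`Ell.exists_cm_loop_relations`, `CurvePeriodsEllipticCMIsogenyProofs.lean`),
and the independence of `1, 2πi, ω₁, η₁` is Masser's Theorem III, proved in the tree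
(`masser_ellipticPeriods_cm_holds`, from Chudnovsky's theorem). Proof: every `E_L`-loop symbol is
`a S₀[D] + b S₁[D] + e𝟙` for a lift `D : z₀ ↝ z₁`, `z₁ − z₀ ∈ Λ` (`Ell.exists_liftData_rel_closed`);
at the generic base point `t₀` of `Ell.exists_cm_loop_relations`, translation
(`Ell.LiftData.span_translate_theta0/1`) and `ℤ`-linearity (`Ell.zexpand`) in the basis
`ω₁, ω₂` reduce it to the basis loops `DU 0 : t₀ ↝ t₀ + ω₁`, `DU 1 : t₀ ↝ t₀ + ω₂`, and the CM
relations eliminate `DU 1`; closed `𝔾ₘ`-symbols are multiples of the standard loop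
(`exists_rel_of_mulGroup_closed`), `𝔸¹`-symbols multiples of `𝟙` (`exists_rel_of_affineLine`);
the period `2Aω₁ − 2Bη₁ + 2πi·Q + E` of the normal form vanishes, so `A = B = Q = E = 0`.
[cite: HuberWustholz2022, Thm. 13.3 (2) (p. 121), §13.2 (pp. 122–125)] [cite: Masser1975, Ch. III Thm. III (p. 36), Lemma 3.1] -/
theorem huberWustholzCurvePeriods_of_ellipticCMLoops
    (L : PeriodPair) (h₂ : IsAlgebraic ℚ L.g₂) (h₃ : IsAlgebraic ℚ L.g₃) (hCM : L.HasCM)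
    (c : PeriodSymbol →₀ ℂ) (hc : ∀ s, IsAlgebraic ℚ (c s))
    (hsupp : ∀ s ∈ c.support,
      (s.Z = Ell.curve L ∧ s.γ.toFun 1 = s.γ.toFun 0) ∨
        (s.Z = (⟨2, 1, ![X 0 * X 1 - 1]⟩ : CurveData) ∧ s.γ.toFun 1 = s.γ.toFun 0) ∨
        s.Z = CurveData.affineLine)
    (h0 : evalCombination c = 0) :
    ∃ (k : ℕ) (ρ : Fin k → (PeriodSymbol →₀ ℂ)) (a : Fin k → ℂ),
      (∀ l, IsElementaryRelation (ρ l)) ∧ (∀ l, IsAlgebraic ℚ (a l)) ∧ c = ∑ l, a l • ρ l := by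
  classical
  -- the standard loop on `𝔾ₘ` and a trivial lift
  obtain ⟨Λ₁, hΛ₁⟩ := exists_stdLoop isAlgebraic_one one_ne_zero (1 : ℤ)
  set ℓ₁ : PeriodSymbol := ⟨⟨2, 1, ![X 0 * X 1 - 1]⟩, isSmoothAffineCurve_mulGroup, ![X 1, 0],
    hasAlgCoeffs_ydx, Λ₁⟩ with hℓ₁
  have hℓ₁per : ℓ₁.period = 2 * Real.pi * I := by
    rw [hℓ₁, period_ydx_stdLoop one_ne_zero 1 Λ₁ hΛ₁]
    simp
  have hg00 : Ell.IsAlgPt L (Ell.vtx L 0 (0, 0)) := Ell.isAlgPt_vtx L h₂ h₃ 0 (0, 0)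
  set D00 : Ell.LiftData L (Ell.vtx L 0 (0, 0)) (Ell.vtx L 0 (0, 0)) := Ell.LiftData.const hg00
  -- Phase A: raw data of every symbol
  have key : ∀ s : PeriodSymbol, ∃ (z₀ z₁ : ℂ) (D : Ell.LiftData L z₀ z₁) (a b qG e : ℂ),
      s ∈ c.support →
      (z₁ - z₀ ∈ L.lattice ∧ IsAlgebraic ℚ a ∧ IsAlgebraic ℚ b ∧ IsAlgebraic ℚ qG ∧
        IsAlgebraic ℚ e ∧
        InSpan (Finsupp.single s (1 : ℂ) -
          a • D.sym h₂ h₃ (Ell.theta0 L) (Ell.hasAlgCoeffs_theta0 L h₂ h₃) -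
          b • D.sym h₂ h₃ (Ell.theta1 L) (Ell.hasAlgCoeffs_theta1 L h₂ h₃) -
          qG • Finsupp.single ℓ₁ (1 : ℂ) -
          e • Finsupp.single PeriodSymbol.unit (1 : ℂ))) := by
    intro s
    by_cases hs : s ∈ c.support
    · rcases hsupp s hs with ⟨hsZ, hcl⟩ | ⟨hsZ, hcl⟩ | hsA
      · obtain ⟨Z, hZ, ω, hω, γ⟩ := s
        dsimp only at hsZ hcl
        subst hsZ
        obtain rfl : hZ = Ell.smooth L h₂ h₃ := rfl
        obtain ⟨z₀, z₁, D, a, b, e, hmem, ha, hb, he, hrel⟩ :=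
          Ell.exists_liftData_rel_closed h₂ h₃ ω hω γ hcl
        refine ⟨z₀, z₁, D, a, b, 0, e, fun _ => ⟨hmem, ha, hb, isAlgebraic_zero, he, ?_⟩⟩
        obtain ⟨k, ρ, cf, hρ, hcf, hsum⟩ := hrel
        exact ⟨k, ρ, cf, hρ, hcf, by rw [← hsum, zero_smul, sub_zero]⟩
      · obtain ⟨q, hq, k, ρ, cf, hρ, hcf, hsum⟩ := exists_rel_of_mulGroup_closed s hsZ hcl Λ₁ hΛ₁
        refine ⟨_, _, D00, 0, 0, q, 0, fun _ =>
          ⟨by simp, isAlgebraic_zero, isAlgebraic_zero, hq, isAlgebraic_zero, ?_⟩⟩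
        exact ⟨k, ρ, cf, hρ, hcf, by rw [← hsum, zero_smul, zero_smul, zero_smul, sub_zero, sub_zero, sub_zero]⟩
      · obtain ⟨π₀, hπ₀, -, hrel⟩ := exists_rel_of_affineLine s hsA
        refine ⟨_, _, D00, 0, 0, 0, π₀, fun _ =>
          ⟨by simp, isAlgebraic_zero, isAlgebraic_zero, isAlgebraic_zero, hπ₀, ?_⟩⟩
        obtain ⟨k, ρ, cf, hρ, hcf, hsum⟩ := span_of_rel hrel
        exact ⟨k, ρ, cf, hρ, hcf, by rw [← hsum, zero_smul, zero_smul, zero_smul, sub_zero, sub_zero, sub_zero]⟩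
    · exact ⟨_, _, D00, 0, 0, 0, 0, fun h => (hs h).elim⟩
  choose z₀ z₁ Dl a b qG e hkey using key
  -- Phase B: lattice coordinates of the displacements `w s = z₁ s − z₀ s ∈ Λ`
  set mv : Fin 2 → ℂ := ![L.ω₁, L.ω₂] with hmv
  have hmvA : ∀ l, Ell.AlgLog L (mv l) := by
    intro l
    fin_cases l
    · exact Ell.algLog_of_mem L.ω₁_mem_lattice
    · exact Ell.algLog_of_mem L.ω₂_mem_lattice
  set w : PeriodSymbol → ℂ := fun s => z₁ s - z₀ s with hw
  have keyn : ∀ s : PeriodSymbol, ∃ n : Fin 2 → ℤ, s ∈ c.support →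
      ∑ l, (n l : ℂ) * mv l = w s := by
    intro s
    by_cases hs : s ∈ c.support
    · obtain ⟨m₀, n₀, hmn⟩ := PeriodPair.mem_lattice.mp (hkey s hs).1
      refine ⟨![m₀, n₀], fun _ => ?_⟩
      rw [Fin.sum_univ_two, hw]
      simpa [hmv] using hmn
    · exact ⟨0, fun h => (hs h).elim⟩
  choose n hn using keyn
  -- Phase C: the generic base point, the basis lifts and the CM relations
  choose Bexp hBexp using fun s : PeriodSymbol => Ell.zexpand (L := L) h₂ h₃ 2 mv hmvA (n s)
  set BD : PeriodSymbol → Finset ℂ := fun s => {z₀ s, 2 * z₀ s, z₀ s - z₁ s, z₀ s + z₁ s} with hBD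
  set Bset : Finset ℂ := c.support.biUnion fun s => Bexp s ∪ BD s with hBset
  obtain ⟨t₀, DU, τ₀, p, q, r, ht₀, hgen, hτ₀, hp, hq, hr, rel0, rel1⟩ :=
    Ell.exists_cm_loop_relations h₂ h₃ hCM Bset
  have hgen_exp : ∀ s ∈ c.support, ∀ b' ∈ Bexp s, t₀ - b' ∉ L.lattice := fun s hs b' hb' =>
    hgen b' (Finset.mem_biUnion.2 ⟨s, hs, Finset.mem_union_left _ hb'⟩)
  have hgen_D : ∀ s ∈ c.support, ∀ b' ∈ BD s, t₀ - b' ∉ L.lattice := fun s hs b' hb' =>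
    hgen b' (Finset.mem_biUnion.2 ⟨s, hs, Finset.mem_union_right _ hb'⟩)
  -- Phase D: per symbol, `s ∼ A S₀[DU 0] + B S₁[DU 0] + qG ℓ₁ + E 𝟙`
  have hper : ∀ s ∈ c.support, ∃ A B E : ℂ, IsAlgebraic ℚ A ∧ IsAlgebraic ℚ B ∧ IsAlgebraic ℚ E ∧
      InSpan (Finsupp.single s (1 : ℂ) -
        A • (DU 0).sym h₂ h₃ (Ell.theta0 L) (Ell.hasAlgCoeffs_theta0 L h₂ h₃) -
        B • (DU 0).sym h₂ h₃ (Ell.theta1 L) (Ell.hasAlgCoeffs_theta1 L h₂ h₃) -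
        qG s • Finsupp.single ℓ₁ (1 : ℂ) -
        E • Finsupp.single PeriodSymbol.unit (1 : ℂ)) := by
    intro s hs
    obtain ⟨-, ha, hb, -, he, hrel⟩ := hkey s hs
    -- genericity at `s`
    have hz0 : t₀ - z₀ s ∉ L.lattice := hgen_D s hs _ (by simp [hBD])
    have h2z0 : t₀ - 2 * z₀ s ∉ L.lattice := hgen_D s hs _ (by simp [hBD])
    have hdiff : t₀ - (z₀ s - z₁ s) ∉ L.lattice := hgen_D s hs _ (by simp [hBD])
    have hsum01 : t₀ - (z₀ s + z₁ s) ∉ L.lattice := hgen_D s hs _ (by simp [hBD])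
    set v : ℂ := t₀ - z₀ s with hv
    have hvA : Ell.AlgLog L v := ht₀.algLog.sub L h₂ (Dl s).alg_start.algLog
    have hvalg : Ell.IsAlgPt L v := hvA.isAlgPt hz0
    have hne0 : ℘[L] (z₀ s) ≠ ℘[L] v := by
      refine (Ell.weierstrassP_ne_iff L (Dl s).alg_start.1 hvalg.1).2 ⟨?_, ?_⟩
      · have e : z₀ s + v = t₀ := by rw [hv]; ring
        rw [e]; exact ht₀.1
      · intro h
        apply h2z0
        have e : t₀ - 2 * z₀ s = -(z₀ s - v) := by rw [hv]; ring
        rw [e]; exact neg_mem h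
    have hne1 : ℘[L] (z₁ s) ≠ ℘[L] v := by
      refine (Ell.weierstrassP_ne_iff L (Dl s).alg_stop.1 hvalg.1).2 ⟨?_, ?_⟩
      · have e : z₁ s + v = t₀ - (z₀ s - z₁ s) := by rw [hv]; ring
        rw [e]; exact hdiff
      · intro h
        apply hsum01
        have e : t₀ - (z₀ s + z₁ s) = -(z₁ s - v) := by rw [hv]; ring
        rw [e]; exact neg_mem h
    have hws : Ell.IsAlgPt L (t₀ + w s) := by
      refine (ht₀.algLog.add L h₂ (((Dl s).alg_stop.algLog).sub L h₂ (Dl s).alg_start.algLog)).isAlgPt ?_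
      have e : t₀ + w s = t₀ - (z₀ s - z₁ s) := by rw [hw]; ring
      rw [e]; exact hdiff
    obtain ⟨Dtr⟩ := Ell.LiftData.nonempty (L := L) (a := t₀) (b := t₀ + w s) ht₀ hws
    have ea : t₀ = z₀ s + v := by rw [hv]; ring
    have eb : t₀ + w s = z₁ s + v := by rw [hv, hw]; ring
    -- translation
    have rt0 := Ell.LiftData.span_translate_theta0 h₂ h₃ hvalg (Dl s) (Dtr.cast ea eb) hne0 hne1
    have rt1 := Ell.LiftData.span_translate_theta1 h₂ h₃ hvalg (Dl s) (Dtr.cast ea eb) hne0 hne1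
    rw [Ell.LiftData.sym_cast] at rt0 rt1
    have hκ := Ell.isAlgebraic_translate_const L hvalg (Dl s).alg_start (Dl s).alg_stop
    -- expansion in the basis `ω₁, ω₂`
    obtain ⟨-, -, hall⟩ := hBexp s t₀ ht₀ (hgen_exp s hs)
    have esum : t₀ + w s = t₀ + ∑ l, (n s l : ℂ) * mv l := by rw [hn s hs]
    obtain ⟨rx0, cx, hcx, rx1⟩ := hall (Dtr.cast rfl esum) DU
    rw [Ell.LiftData.sym_cast] at rx0 rx1
    simp only [Fin.sum_univ_two] at rx0 rx1
    have hn0 : IsAlgebraic ℚ ((n s 0 : ℤ) : ℂ) := isAlgebraic_int _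
    have hn1 : IsAlgebraic ℚ ((n s 1 : ℤ) : ℂ) := isAlgebraic_int _
    refine ⟨a s * ((n s 0 : ℂ) + (n s 1 : ℂ) * τ₀) + b s * ((n s 1 : ℂ) * q),
      b s * ((n s 0 : ℂ) + (n s 1 : ℂ) * p),
      e s + b s * ((n s 1 : ℂ) * r + cx -
        (eval (Ell.psiT L v (z₁ s)) (Ell.rPolyT L v) - eval (Ell.psiT L v (z₀ s)) (Ell.rPolyT L v))),
      (ha.mul (hn0.add (hn1.mul hτ₀))).add (hb.mul (hn1.mul hq)),
      hb.mul (hn0.add (hn1.mul hp)),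
      he.add (hb.mul (((hn1.mul hr).add hcx).sub hκ)), ?_⟩
    obtain ⟨K, ρ, cf, hρ, hcf, hsum⟩ :=
      span_add (span_add hrel (span_smul ha (span_add (span_sub rx0 rt0) (span_smul hn1 rel0))))
        (span_smul hb (span_add (span_sub rx1 rt1) (span_smul hn1 rel1)))
    refine ⟨K, ρ, cf, hρ, hcf, ?_⟩
    rw [← hsum]
    module
  have hper' : ∀ s : PeriodSymbol, ∃ A B E : ℂ, s ∈ c.support → (IsAlgebraic ℚ A ∧ IsAlgebraic ℚ B ∧
      IsAlgebraic ℚ E ∧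
      InSpan (Finsupp.single s (1 : ℂ) -
        A • (DU 0).sym h₂ h₃ (Ell.theta0 L) (Ell.hasAlgCoeffs_theta0 L h₂ h₃) -
        B • (DU 0).sym h₂ h₃ (Ell.theta1 L) (Ell.hasAlgCoeffs_theta1 L h₂ h₃) -
        qG s • Finsupp.single ℓ₁ (1 : ℂ) -
        E • Finsupp.single PeriodSymbol.unit (1 : ℂ))) := by
    intro s
    by_cases hs : s ∈ c.support
    · obtain ⟨A, B, E, hA, hB, hE, h⟩ := hper s hs
      exact ⟨A, B, E, fun _ => ⟨hA, hB, hE, h⟩⟩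
    · exact ⟨0, 0, 0, fun h => (hs h).elim⟩
  choose A B E hABE using hper'
  -- Phase E: sum over the support
  set T0 := (DU 0).sym h₂ h₃ (Ell.theta0 L) (Ell.hasAlgCoeffs_theta0 L h₂ h₃) with hT0
  set T1 := (DU 0).sym h₂ h₃ (Ell.theta1 L) (Ell.hasAlgCoeffs_theta1 L h₂ h₃) with hT1
  have hspan' : ∀ T : Finset PeriodSymbol, T ⊆ c.support →
      InSpan (∑ s ∈ T, c s • (Finsupp.single s (1 : ℂ) - A s • T0 - B s • T1 -
        qG s • Finsupp.single ℓ₁ (1 : ℂ) - E s • Finsupp.single PeriodSymbol.unit (1 : ℂ))) := by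
    intro T hT
    induction T using Finset.induction_on with
    | empty => simpa using span_zero
    | insert s T hs ih =>
      rw [Finset.sum_insert hs]
      exact span_add (span_smul (hc s) (hABE s (hT (Finset.mem_insert_self s T))).2.2.2)
        (ih (subset_trans (Finset.subset_insert s T) hT))
  obtain ⟨k, ρ, cf, hρ, hcf, hmain⟩ := hspan' c.support subset_rfl
  set Atot : ℂ := ∑ s ∈ c.support, c s * A s with hAtot
  set Btot : ℂ := ∑ s ∈ c.support, c s * B s with hBtot
  set Qtot : ℂ := ∑ s ∈ c.support, c s * qG s with hQtot
  set Etot : ℂ := ∑ s ∈ c.support, c s * E s with hEtot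
  have hc_eq : c = ∑ s ∈ c.support, c s • Finsupp.single s (1 : ℂ) := by
    conv_lhs => rw [← Finsupp.sum_single c]
    simp only [Finsupp.sum, Finsupp.smul_single_one]
  have hident : ∑ s ∈ c.support, c s • (Finsupp.single s (1 : ℂ) - A s • T0 - B s • T1 -
        qG s • Finsupp.single ℓ₁ (1 : ℂ) - E s • Finsupp.single PeriodSymbol.unit (1 : ℂ)) =
      c - (Atot • T0 + Btot • T1 + Qtot • Finsupp.single ℓ₁ (1 : ℂ) +
        Etot • Finsupp.single PeriodSymbol.unit (1 : ℂ)) := by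
    simp only [smul_sub, smul_smul, Finset.sum_sub_distrib, ← hc_eq, hAtot, hBtot, hQtot, hEtot,
      Finset.sum_smul]
    abel
  rw [hident] at hmain
  -- the period of the normal form vanishes
  have hevT0 : evalCombination T0 = 2 * L.ω₁ := by
    rw [hT0, Ell.LiftData.evalCombination_sym_theta0, add_sub_cancel_left]
    simp
  have hevT1 : evalCombination T1 = -2 * L.η₁ := by
    rw [hT1, Ell.LiftData.evalCombination_sym_theta1]
    simp only [Matrix.cons_val_zero]
    have h := L.weierstrassZeta_add_int_mul_ω₁ 1 t₀
    simp only [Int.cast_one, one_mul] at h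
    rw [h]
    ring
  have hev : 2 * Atot * L.ω₁ + (-2 * Btot) * L.η₁ + Qtot * (2 * Real.pi * I) + Etot = 0 := by
    have h1 := evalCombination_eq_zero_of_isElementaryRelation ρ cf hρ
    rw [← hmain, sub_eq_add_neg, evalCombination_add, h0, zero_add, ← neg_one_smul ℂ,
      evalCombination_smul, evalCombination_add, evalCombination_add, evalCombination_add,
      evalCombination_smul, evalCombination_smul, evalCombination_smul, evalCombination_smul,
      evalCombination_single, evalCombination_single, period_unit, hℓ₁per, hevT0, hevT1] at h1
    rw [neg_one_mul, neg_eq_zero] at h1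
    linear_combination h1
  -- algebraicity of the coefficients
  have hAalg : IsAlgebraic ℚ Atot := isAlgebraic_finsetSum _ _ fun s hs => (hc s).mul (hABE s hs).1
  have hBalg : IsAlgebraic ℚ Btot := isAlgebraic_finsetSum _ _ fun s hs => (hc s).mul (hABE s hs).2.1
  have hQalg : IsAlgebraic ℚ Qtot :=
    isAlgebraic_finsetSum _ _ fun s hs => (hc s).mul (hkey s hs).2.2.2.1
  have hEalg : IsAlgebraic ℚ Etot :=
    isAlgebraic_finsetSum _ _ fun s hs => (hc s).mul (hABE s hs).2.2.1
  -- Masser's Theorem III: `1, 2πi, ω₁, η₁` are `ℚ̄`-linearly independent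
  set β : Fin 4 → ℂ := ![Etot, Qtot, 2 * Atot, -2 * Btot] with hβ
  have hβalg : ∀ i, IsAlgebraic ℚ (β i) := by
    intro i
    fin_cases i
    · exact hEalg
    · exact hQalg
    · exact Ell.isAlgebraic_two.mul hAalg
    · exact Ell.isAlgebraic_two.neg.mul hBalg
  have hβsum : ∑ i, β i * ![1, 2 * Real.pi * I, L.ω₁, L.η₁] i = 0 := by
    simp only [Fin.sum_univ_four, hβ, Matrix.cons_val_zero, Matrix.cons_val_one, Matrix.head_cons,
      Matrix.cons_val_two, Matrix.tail_cons, Matrix.cons_val_three]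
    linear_combination hev
  have hzero := masser_ellipticPeriods_cm_holds L h₂ h₃ hCM β hβalg hβsum
  have hE0 : Etot = 0 := by simpa [hβ] using hzero 0
  have hQ0 : Qtot = 0 := by simpa [hβ] using hzero 1
  have hA0 : Atot = 0 := by
    have h := hzero 2
    simpa [hβ] using h
  have hB0 : Btot = 0 := by
    have h := hzero 3
    simpa [hβ] using h
  refine ⟨k, ρ, cf, hρ, hcf, ?_⟩
  rw [← hmain, hA0, hB0, hQ0, hE0]
  simp

/-- **Huber–Wüstholz, Theorem 13.3 (2), for closed paths on ANY elliptic curve `E_L` with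
`g₂, g₃ ∈ ℚ̄` (with or without complex multiplication), together with closed paths on `𝔾ₘ` and
`𝔸¹` — PROVED** (CM: `huberWustholzCurvePeriods_of_ellipticCMLoops`; no CM:
`huberWustholzCurvePeriods_ellipticLoops` of `CurvePeriodsEllipticEndgameHolds.lean`, which even
allows open paths on `𝔾ₘ`). [cite: HuberWustholz2022, Thm. 13.3 (2) (p. 121), §13.2 (pp. 122–125)] [cite: Masser1975, Ch. II Thm. II, Ch. III Thm. III] -/
theorem huberWustholzCurvePeriods_ellipticLoops_all
    (L : PeriodPair) (h₂ : IsAlgebraic ℚ L.g₂) (h₃ : IsAlgebraic ℚ L.g₃)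
    (c : PeriodSymbol →₀ ℂ) (hc : ∀ s, IsAlgebraic ℚ (c s))
    (hsupp : ∀ s ∈ c.support,
      (s.Z = Ell.curve L ∧ s.γ.toFun 1 = s.γ.toFun 0) ∨
        (s.Z = (⟨2, 1, ![X 0 * X 1 - 1]⟩ : CurveData) ∧ s.γ.toFun 1 = s.γ.toFun 0) ∨
        s.Z = CurveData.affineLine)
    (h0 : evalCombination c = 0) :
    ∃ (k : ℕ) (ρ : Fin k → (PeriodSymbol →₀ ℂ)) (a : Fin k → ℂ),
      (∀ l, IsElementaryRelation (ρ l)) ∧ (∀ l, IsAlgebraic ℚ (a l)) ∧ c = ∑ l, a l • ρ l := by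
  by_cases hCM : L.HasCM
  · exact huberWustholzCurvePeriods_of_ellipticCMLoops L h₂ h₃ hCM c hc hsupp h0
  · refine huberWustholzCurvePeriods_ellipticLoops L h₂ h₃ hCM c hc (fun s hs => ?_) h0
    rcases hsupp s hs with h | ⟨h, -⟩ | h
    · exact Or.inl h
    · exact Or.inr (Or.inl h)
    · exact Or.inr (Or.inr h)

end Main

end CurvePeriods

end Literature.NumberTheory.Transcendental

end
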